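import Mathlib
import Literature.Probability.MarkovChains.TotalVariation
import Literature.Probability.Entropy.PinskerInequality
import Literature.InformationTheory.Entropy.GibbsInequality
import Summits.Ventures.LatticeQCDFlow.Scaling.ImportanceWeights
import Summits.Ventures.LatticeQCDFlow.Scaling.Pseudofermions
import Summits.Ventures.LatticeQCDFlow.Scaling.BlockDefect

/-!
# LatticeQCDFlow / Scaling — the hierarchical (multiscale / domain-decomposition) volume law (T2-AJ)

HONEST FRAMING: exact (Metropolis-corrected) sampling algorithms for lattice gauge theory;
figures of merit are autocorrelation/cost numbers at stated couplings and volumes; no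
continuum-physics claim.

Venture `LatticeQCDFlow` (cell pub-lqcd), topic `Scaling`, item 119a = T2-AJ of HOME/THEORY-2.md
§3.1 (hv) / §4 (v4.6), prepared by the theory seat (FANOUT row 29) on top of the tree's
`Scaling/BlockDefect` (T2-H, T2-I), `Scaling/CovDefect` (T2-N), `Scaling/ImportanceWeights`
(T2-A, T2-B) and `Scaling/Pseudofermions` (`margU`).  Finite state spaces, laws of full support.

The block-defect volume law T2-I (`blockDefect_volume_law`) prices a model that is a PRODUCT
across blocks.  Its two named evasions (`Barriers.VolumeScalingOfTraining`,
`Barriers.ReceptiveFieldLaw`: "multiscale architectures; non-product priors — the law prices only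
the residual") — multiscale / hierarchical flows, which sample a coarse lattice first and the
fine field conditionally on it [cite: AbbottEtAl2024Multiscale], and domain decomposition, which
samples the interiors of domains conditionally on a separator [cite: Finkenrath2022, §3–4] — are
models of the form `q(c, φ) = a(c) · Π_i k_{c,i}(φ_i)` (`kerLaw a (fun c => blockProd (k c))`):
a coarse law `a` of a coarse variable `c` (block spins, a separator / boundary field, a sector
label) times a kernel that is a product over the `m` fine blocks GIVEN `c`.  For such models and
ANY joint target `r(c, φ)` (`margU r` its coarse marginal, `condLaw r c` its conditional law):

* `klFin_kerLaw_eq` — the chain rule `D(r ‖ a·κ) = D(r_C ‖ a) + Σ_c r_C(c)·D(r(·|c) ‖ κ_c)`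
  [cite: CoverThomas2006, Thm 2.5.3]; `inv_essFrac_kerLaw_eq` — the matching identity
  `1/ESS(r, a·κ) = Σ_c (r_C(c)²/a(c)) · 1/ESS(r(·|c), κ_c)`, hence
  `ESS ≤ ESS(r_C, a) · max_c ESS(r(·|c), κ_c)` (`essFrac_kerLaw_le`): the coarse level and the
  conditional level pay SEPARATELY;
* `hierarchical_volume_law_sq` / `hierarchical_volume_law` / `HierarchicalVolumeLaw` (T2-AJ) —
  `D(r ‖ q) ≥ D(r_C ‖ a) + Σ_i 2·δ̄_i² ≥ D(r_C ‖ a) + 2 m δ²`, where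
  `δ̄_i = Σ_c r_C(c)·TV(r(φ_i = · | c), k_{c,i})` is the MEAN CONDITIONAL DEFECT of block `i`
  (chain rule; fibrewise `klFin_blockProd_eq` + Gibbs + sharp Pinsker; Jensen over `c`); with
  T2-A, `ess_hierarchical_volume_law`: `ESS/N ≤ exp(−D(r_C‖a) − 2 m δ²)` — the conditional level
  is AGAIN exponential in the number of fine blocks, i.e. in the volume at fixed block size;
* companion file `Scaling/HierarchicalVolumeLawExact.lean` (item 119b): the CONDITIONAL T2-N
  (`condCov_le_condDefect`: the mean conditional defect is at least one sixth of the mean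
  conditional connected cross-cut correlator given the coarse field) and EXACT additivity /
  multiplicativity of both budgets when the TARGET too is a product over the fine blocks given `c`
  (Markov targets given a separator: domain decomposition; `klFin_kerLaw_blockProd_eq`).

Iterating the chain rule over levels gives additivity over SCALES (an `L`-level hierarchy pays
`Σ_ℓ 2 m_ℓ δ_ℓ²`, `hierarchical_volume_law_of_coarse_bound`).  The physics input — a conditional
defect `δ > 0` uniformly in the volume, i.e. conditioning on the coarse field does NOT make the
fine field independent across the cuts the conditional model cannot see — is hypothesis (U-c) of
THEORY-2.md §3.1 (hv), the conditional form of (U); like (U) it is NOT asserted here.  Coarse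
variables that are deterministic functions of the fine field (block averages) are covered after
the change of fine coordinates `φ_i ↦ (c_i, ζ_i)`: the statements are over an arbitrary joint
law `r` on `C × (Fin m → Z)` of full support.

Elementary (`[folklore]`-level); farm `lean check` rc 0, no `sorry`.
-/

namespace Summit.Ventures.LatticeQCDFlow.Theory2

open Finset
open Literature.Probability.MarkovChains Literature.Probability.Entropy

variable {C : Type*} [Fintype C] {X : Type*} [Fintype X]

/-! ## Coarse law × conditional kernel: definitions and bookkeeping -/

section Kernel

/-- The joint law `(c, x) ↦ a(c)·κ_c(x)` of a coarse law `a` followed by a conditional kernel `κ`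
(a two-level hierarchical / conditional model). [folklore] -/
noncomputable def kerLaw (a : C → ℝ) (κ : C → X → ℝ) : C × X → ℝ := fun z => a z.1 * κ z.1 z.2

/-- The conditional law `x ↦ r(c, x) / r_C(c)` of the fine variable given the coarse one.
[folklore] -/
noncomputable def condLaw (r : C × X → ℝ) (c : C) : X → ℝ := fun x => r (c, x) / margU r c

omit [Fintype C] [Fintype X] in
/-- `kerLaw` of positive data is positive. [folklore] -/
theorem kerLaw_pos {a : C → ℝ} (ha : ∀ c, 0 < a c) {κ : C → X → ℝ} (hκ : ∀ c x, 0 < κ c x)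
    (z : C × X) : 0 < kerLaw a κ z :=
  mul_pos (ha z.1) (hκ z.1 z.2)

omit [Fintype C] in
/-- Coarse marginal of `kerLaw a κ`: `a(c)·Σ_x κ_c(x)` (`= a(c)` for a Markov kernel). [folklore] -/
theorem margU_kerLaw (a : C → ℝ) (κ : C → X → ℝ) (c : C) :
    margU (kerLaw a κ) c = a c * ∑ x, κ c x := by
  show ∑ x, a c * κ c x = a c * ∑ x, κ c x
  rw [mul_sum]

/-- Total mass of `kerLaw a κ`. [folklore] -/
theorem sum_kerLaw (a : C → ℝ) (κ : C → X → ℝ) :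
    ∑ z, kerLaw a κ z = ∑ c, a c * ∑ x, κ c x := by
  rw [← sum_margU]
  exact sum_congr rfl fun c _ => margU_kerLaw a κ c

omit [Fintype C] in
/-- `r_C(c) · r(x | c) = r(c, x)`. [folklore] -/
theorem margU_mul_condLaw {r : C × X → ℝ} {c : C} (h : margU r c ≠ 0) (x : X) :
    margU r c * condLaw r c x = r (c, x) := by
  unfold condLaw
  rw [mul_div_assoc', mul_comm, mul_div_assoc, div_self h, mul_one]

omit [Fintype C] in
/-- A conditional law is normalised. [folklore] -/
theorem sum_condLaw {r : C × X → ℝ} {c : C} (h : margU r c ≠ 0) : ∑ x, condLaw r c x = 1 := by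
  unfold condLaw
  rw [← sum_div, div_eq_one_iff_eq h]
  rfl

omit [Fintype C] in
/-- Conditional laws of a positive joint law are positive. [folklore] -/
theorem condLaw_pos [Nonempty X] {r : C × X → ℝ} (hr : ∀ z, 0 < r z) (c : C) (x : X) :
    0 < condLaw r c x :=
  div_pos (hr (c, x)) (margU_pos hr c)

omit [Fintype C] in
/-- The conditional law of `kerLaw b ρ` given `c` is `ρ_c` (Markov kernel `ρ`, `b > 0`).
[folklore] -/
theorem condLaw_kerLaw {b : C → ℝ} (hb : ∀ c, 0 < b c) {ρ : C → X → ℝ} (hρ1 : ∀ c, ∑ x, ρ c x = 1)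
    (c : C) (x : X) : condLaw (kerLaw b ρ) c x = ρ c x := by
  unfold condLaw
  rw [margU_kerLaw, hρ1, mul_one]
  show b c * ρ c x / b c = ρ c x
  rw [mul_comm, mul_div_assoc, div_self (hb c).ne', mul_one]

/-- ESS is positive for positive, normalised data (local copy of `Theory2.essFrac_pos` of
`Scaling/VarianceLaws`, kept private to keep the imports minimal). -/
private theorem essFrac_pos_aux [Nonempty X] {p q : X → ℝ} (hp : ∀ x, 0 < p x)
    (hq : ∀ x, 0 < q x) (hp1 : ∑ x, p x = 1) : 0 < essFrac p q := by
  rw [essFrac_eq_inv hq hp1]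
  refine inv_pos.2 (sum_pos (fun x _ => ?_) univ_nonempty)
  rw [mul_weight_eq_sq_div]
  exact div_pos (pow_pos (hp x) 2) (hq x)

/-! ## The chain rule and the ESS identity for conditional models -/

/-- **Chain rule of the forward KL for a conditional model** [cite: CoverThomas2006, Thm 2.5.3]:
`D(r ‖ a·κ) = D(r_C ‖ a) + Σ_c r_C(c) · D(r(·|c) ‖ κ_c)`. [folklore] -/
theorem klFin_kerLaw_eq [Nonempty X] {r : C × X → ℝ} (hr : ∀ z, 0 < r z) {a : C → ℝ}
    (ha : ∀ c, 0 < a c) {κ : C → X → ℝ} (hκ : ∀ c x, 0 < κ c x) :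
    klFin r (kerLaw a κ) = klFin (margU r) a + ∑ c, margU r c * klFin (condLaw r c) (κ c) := by
  have hm : ∀ c, 0 < margU r c := margU_pos hr
  have hpt : ∀ c x, r (c, x) * Real.log (r (c, x) / kerLaw a κ (c, x)) =
      r (c, x) * Real.log (margU r c / a c) +
        margU r c * (condLaw r c x * Real.log (condLaw r c x / κ c x)) := by
    intro c x
    rw [← mul_assoc, margU_mul_condLaw (hm c).ne' x, ← mul_add,
      ← Real.log_mul (div_pos (hm c) (ha c)).ne' (div_pos (condLaw_pos hr c x) (hκ c x)).ne']
    congr 1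
    congr 1
    have h1 : a c ≠ 0 := (ha c).ne'
    have h2 : κ c x ≠ 0 := (hκ c x).ne'
    have h3 : margU r c ≠ 0 := (hm c).ne'
    simp only [kerLaw, condLaw]
    field_simp
  unfold klFin
  rw [Fintype.sum_prod_type, ← sum_add_distrib]
  refine sum_congr rfl fun c _ => ?_
  rw [sum_congr rfl fun x _ => hpt c x, sum_add_distrib, ← sum_mul, ← mul_sum]
  rfl

/-- Data processing for the coarse variable: `D(r_C ‖ a) ≤ D(r ‖ a·κ)`. [folklore] -/
theorem klFin_margU_le_klFin_kerLaw [Nonempty X] {r : C × X → ℝ} (hr : ∀ z, 0 < r z)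
    {a : C → ℝ} (ha : ∀ c, 0 < a c) {κ : C → X → ℝ} (hκ : ∀ c x, 0 < κ c x)
    (hκ1 : ∀ c, ∑ x, κ c x = 1) : klFin (margU r) a ≤ klFin r (kerLaw a κ) := by
  have hm : ∀ c, 0 < margU r c := margU_pos hr
  rw [klFin_kerLaw_eq hr ha hκ]
  have h : ∀ c, 0 ≤ margU r c * klFin (condLaw r c) (κ c) := fun c =>
    mul_nonneg (hm c).le (klFin_nonneg (fun x => (condLaw_pos hr c x).le) (hκ c)
      (by rw [sum_condLaw (hm c).ne', hκ1 c]))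
  linarith [sum_nonneg fun c (_ : c ∈ (univ : Finset C)) => h c]

/-- **ESS identity for a conditional model**:
`1/ESS(r, a·κ) = Σ_c (r_C(c)² / a(c)) · 1/ESS(r(·|c), κ_c)` (`1/ESS = 1 + χ²` fibrewise).
[folklore] -/
theorem inv_essFrac_kerLaw_eq [Nonempty X] {r : C × X → ℝ} (hr : ∀ z, 0 < r z)
    (hr1 : ∑ z, r z = 1) {a : C → ℝ} (ha : ∀ c, 0 < a c) {κ : C → X → ℝ}
    (hκ : ∀ c x, 0 < κ c x) :
    (essFrac r (kerLaw a κ))⁻¹ = ∑ c, margU r c ^ 2 / a c * (essFrac (condLaw r c) (κ c))⁻¹ := by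
  have hm : ∀ c, 0 < margU r c := margU_pos hr
  rw [essFrac_eq_inv (kerLaw_pos ha hκ) hr1, inv_inv]
  simp_rw [mul_weight_eq_sq_div]
  rw [Fintype.sum_prod_type]
  refine sum_congr rfl fun c _ => ?_
  rw [essFrac_eq_inv (hκ c) (sum_condLaw (hm c).ne'), inv_inv]
  simp_rw [mul_weight_eq_sq_div]
  rw [mul_sum]
  refine sum_congr rfl fun x _ => ?_
  have h1 : a c ≠ 0 := (ha c).ne'
  have h2 : κ c x ≠ 0 := (hκ c x).ne'
  have h3 : margU r c ≠ 0 := (hm c).ne'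
  simp only [kerLaw, condLaw]
  field_simp

/-- **The two levels pay separately**: if every conditional ESS is `≤ E`, then
`ESS(r, a·κ) ≤ ESS(r_C, a) · E`. [folklore] -/
theorem essFrac_kerLaw_le [Nonempty X] {r : C × X → ℝ} (hr : ∀ z, 0 < r z)
    (hr1 : ∑ z, r z = 1) {a : C → ℝ} (ha : ∀ c, 0 < a c) {κ : C → X → ℝ}
    (hκ : ∀ c x, 0 < κ c x) {E : ℝ} (hE : 0 < E)
    (hcond : ∀ c, essFrac (condLaw r c) (κ c) ≤ E) :
    essFrac r (kerLaw a κ) ≤ essFrac (margU r) a * E := by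
  have hC : Nonempty C := by
    by_contra h
    rw [not_nonempty_iff] at h
    have : ∑ z : C × X, r z = 0 := by
      rw [Fintype.sum_prod_type]; exact Fintype.sum_empty _
    linarith
  have hm : ∀ c, 0 < margU r c := margU_pos hr
  have hm1 : ∑ c, margU r c = 1 := by rw [sum_margU, hr1]
  have hcpos : ∀ c, 0 < essFrac (condLaw r c) (κ c) := fun c =>
    essFrac_pos_aux (condLaw_pos hr c) (hκ c) (sum_condLaw (hm c).ne')
  have hapos : 0 < essFrac (margU r) a := essFrac_pos_aux hm ha hm1
  have hcoarse : (essFrac (margU r) a)⁻¹ = ∑ c, margU r c ^ 2 / a c := by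
    rw [essFrac_eq_inv ha hm1, inv_inv]
    exact sum_congr rfl fun c _ => mul_weight_eq_sq_div _ _ _
  have key : (essFrac (margU r) a)⁻¹ * E⁻¹ ≤ (essFrac r (kerLaw a κ))⁻¹ := by
    rw [inv_essFrac_kerLaw_eq hr hr1 ha hκ, hcoarse, sum_mul]
    refine sum_le_sum fun c _ => ?_
    exact mul_le_mul_of_nonneg_left (inv_anti₀ (hcpos c) (hcond c))
      (div_nonneg (sq_nonneg _) (ha c).le)
  have hA : 0 < (essFrac (margU r) a)⁻¹ * E⁻¹ := mul_pos (inv_pos.2 hapos) (inv_pos.2 hE)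
  calc essFrac r (kerLaw a κ) = ((essFrac r (kerLaw a κ))⁻¹)⁻¹ := (inv_inv _).symm
    _ ≤ ((essFrac (margU r) a)⁻¹ * E⁻¹)⁻¹ := inv_anti₀ hA key
    _ = essFrac (margU r) a * E := by rw [mul_inv, inv_inv, inv_inv]

end Kernel

/-! ## The hierarchical volume law (T2-AJ) -/

section Hierarchical

variable {m : ℕ} {Z : Type*} [Fintype Z] [DecidableEq Z] [Nonempty Z]

/-- Jensen for the square: `(Σ w t)² ≤ Σ w t²` for positive weights of total mass one. -/
private theorem sq_sum_mul_le_sum_mul_sq {ι : Type*} (s : Finset ι) {w t : ι → ℝ}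
    (hw : ∀ i ∈ s, 0 < w i) (hw1 : ∑ i ∈ s, w i = 1) :
    (∑ i ∈ s, w i * t i) ^ 2 ≤ ∑ i ∈ s, w i * t i ^ 2 := by
  have h := Finset.sq_sum_div_le_sum_sq_div s (fun i => w i * t i) hw
  rw [hw1, div_one] at h
  refine h.trans (le_of_eq (sum_congr rfl fun i hi => ?_))
  rw [div_eq_iff (hw i hi).ne']
  ring

/-- **T2-AJ, squared form.**  For ANY joint target `r` on `C × (Fin m → Z)` and the hierarchical
model `q(c, φ) = a(c)·Π_i k_{c,i}(φ_i)`: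
`D(r_C ‖ a) + Σ_i 2·(Σ_c r_C(c)·TV(r(φ_i = ·|c), k_{c,i}))² ≤ D(r ‖ q)`. [folklore] -/
theorem hierarchical_volume_law_sq {r : C × (Fin m → Z) → ℝ} (hr : ∀ z, 0 < r z)
    (hr1 : ∑ z, r z = 1) {a : C → ℝ} (ha : ∀ c, 0 < a c) {k : C → Fin m → Z → ℝ}
    (hk : ∀ c i z, 0 < k c i z) (hk1 : ∀ c i, ∑ z, k c i z = 1) :
    klFin (margU r) a +
        ∑ i, 2 * (∑ c, margU r c * tvDist (blockMarg (condLaw r c) i) (k c i)) ^ 2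
      ≤ klFin r (kerLaw a fun c => blockProd (k c)) := by
  have hm : ∀ c, 0 < margU r c := margU_pos hr
  have hm1 : ∑ c, margU r c = 1 := by rw [sum_margU, hr1]
  have hcpos : ∀ c φ, 0 < condLaw r c φ := condLaw_pos hr
  have hc1 : ∀ c, ∑ φ, condLaw r c φ = 1 := fun c => sum_condLaw (hm c).ne'
  have hbm : ∀ c i z, 0 < blockMarg (condLaw r c) i z := fun c => blockMarg_pos (hcpos c)
  have hbm1 : ∀ c i, ∑ z, blockMarg (condLaw r c) i z = 1 := fun c i => by
    rw [sum_blockMarg, hc1]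
  -- sharp Pinsker per (c, i)
  have hpin : ∀ c i, 2 * tvDist (blockMarg (condLaw r c) i) (k c i) ^ 2
      ≤ klFin (blockMarg (condLaw r c) i) (k c i) :=
    fun c i => two_mul_tvDist_sq_le_kl (hbm c i) (hk c i) (hbm1 c i) (hk1 c i)
  -- fibrewise chain rule over the blocks + Gibbs
  have hfib : ∀ c, ∑ i, klFin (blockMarg (condLaw r c) i) (k c i)
      ≤ klFin (condLaw r c) (blockProd (k c)) := by
    intro c
    rw [klFin_blockProd_eq (hcpos c) (hk c)]
    have hI : 0 ≤ klFin (condLaw r c) (blockProd (blockMarg (condLaw r c))) := by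
      refine klFin_nonneg (fun φ => (hcpos c φ).le) (blockProd_pos (hbm c)) ?_
      rw [sum_blockProd, hc1 c]
      simp_rw [hbm1 c]
      simp
    linarith
  -- Jensen over the coarse variable
  have hjensen : ∀ i, (∑ c, margU r c * tvDist (blockMarg (condLaw r c) i) (k c i)) ^ 2
      ≤ ∑ c, margU r c * tvDist (blockMarg (condLaw r c) i) (k c i) ^ 2 :=
    fun i => sq_sum_mul_le_sum_mul_sq univ (fun c _ => hm c) hm1
  have h2 : ∑ i, 2 * (∑ c, margU r c * tvDist (blockMarg (condLaw r c) i) (k c i)) ^ 2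
      ≤ ∑ c, margU r c * klFin (condLaw r c) (blockProd (k c)) :=
    calc ∑ i, 2 * (∑ c, margU r c * tvDist (blockMarg (condLaw r c) i) (k c i)) ^ 2
        ≤ ∑ i, 2 * ∑ c, margU r c * tvDist (blockMarg (condLaw r c) i) (k c i) ^ 2 :=
          sum_le_sum fun i _ => mul_le_mul_of_nonneg_left (hjensen i) two_pos.le
      _ = ∑ c, margU r c * ∑ i, 2 * tvDist (blockMarg (condLaw r c) i) (k c i) ^ 2 := by
          simp_rw [mul_sum]
          rw [sum_comm]
          exact sum_congr rfl fun _ _ => sum_congr rfl fun _ _ => by ring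
      _ ≤ ∑ c, margU r c * ∑ i, klFin (blockMarg (condLaw r c) i) (k c i) :=
          sum_le_sum fun c _ => mul_le_mul_of_nonneg_left (sum_le_sum fun i _ => hpin c i)
            (hm c).le
      _ ≤ ∑ c, margU r c * klFin (condLaw r c) (blockProd (k c)) :=
          sum_le_sum fun c _ => mul_le_mul_of_nonneg_left (hfib c) (hm c).le
  rw [klFin_kerLaw_eq hr ha (fun c φ => blockProd_pos (hk c) φ)]
  linarith

/-- **T2-AJ (the hierarchical volume law).**  If the MEAN CONDITIONAL DEFECT of every fine block
is `≥ δ` — `Σ_c r_C(c)·TV(r(φ_i = ·|c), k_{c,i}) ≥ δ` — then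
`D(r_C ‖ a) + m·2δ² ≤ D(r ‖ q)`: the conditional level is extensive in the number of fine blocks
ON TOP of the coarse level's own divergence. [folklore] -/
theorem hierarchical_volume_law {r : C × (Fin m → Z) → ℝ} (hr : ∀ z, 0 < r z)
    (hr1 : ∑ z, r z = 1) {a : C → ℝ} (ha : ∀ c, 0 < a c) {k : C → Fin m → Z → ℝ}
    (hk : ∀ c i z, 0 < k c i z) (hk1 : ∀ c i, ∑ z, k c i z = 1) {δ : ℝ} (hδ : 0 ≤ δ)
    (hdef : ∀ i, δ ≤ ∑ c, margU r c * tvDist (blockMarg (condLaw r c) i) (k c i)) :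
    klFin (margU r) a + (m : ℝ) * (2 * δ ^ 2) ≤ klFin r (kerLaw a fun c => blockProd (k c)) := by
  have h := hierarchical_volume_law_sq hr hr1 ha hk hk1
  have hi : ∀ i, 2 * δ ^ 2
      ≤ 2 * (∑ c, margU r c * tvDist (blockMarg (condLaw r c) i) (k c i)) ^ 2 :=
    fun i => mul_le_mul_of_nonneg_left (pow_le_pow_left₀ hδ (hdef i) 2) two_pos.le
  have hsum : (m : ℝ) * (2 * δ ^ 2)
      ≤ ∑ i, 2 * (∑ c, margU r c * tvDist (blockMarg (condLaw r c) i) (k c i)) ^ 2 := by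
    have := sum_le_sum fun i (_ : i ∈ (univ : Finset (Fin m))) => hi i
    simpa using this
  linarith

/-- **T2-AJ with a per-fibre defect** (the form closest to T2-I): a conditional defect `≥ δ` for
EVERY value of the coarse variable gives a mean conditional defect `≥ δ`. [folklore] -/
theorem hierarchical_volume_law_of_forall {r : C × (Fin m → Z) → ℝ} (hr : ∀ z, 0 < r z)
    (hr1 : ∑ z, r z = 1) {a : C → ℝ} (ha : ∀ c, 0 < a c) {k : C → Fin m → Z → ℝ}
    (hk : ∀ c i z, 0 < k c i z) (hk1 : ∀ c i, ∑ z, k c i z = 1) {δ : ℝ} (hδ : 0 ≤ δ)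
    (hdef : ∀ c i, δ ≤ tvDist (blockMarg (condLaw r c) i) (k c i)) :
    klFin (margU r) a + (m : ℝ) * (2 * δ ^ 2) ≤ klFin r (kerLaw a fun c => blockProd (k c)) := by
  have hm : ∀ c, 0 < margU r c := margU_pos hr
  have hm1 : ∑ c, margU r c = 1 := by rw [sum_margU, hr1]
  refine hierarchical_volume_law hr hr1 ha hk hk1 hδ fun i => ?_
  calc δ = ∑ c, margU r c * δ := by rw [← sum_mul, hm1, one_mul]
    _ ≤ ∑ c, margU r c * tvDist (blockMarg (condLaw r c) i) (k c i) :=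
        sum_le_sum fun c _ => mul_le_mul_of_nonneg_left (hdef c i) (hm c).le

/-- **Additivity over scales** (the induction step of an `L`-level hierarchy): a lower bound
`K ≤ D(r_C ‖ a)` for the coarse level — e.g. T2-AJ applied to the coarse law itself — adds to
the fine level's `2 m δ²`. [folklore] -/
theorem hierarchical_volume_law_of_coarse_bound {r : C × (Fin m → Z) → ℝ} (hr : ∀ z, 0 < r z)
    (hr1 : ∑ z, r z = 1) {a : C → ℝ} (ha : ∀ c, 0 < a c) {k : C → Fin m → Z → ℝ}
    (hk : ∀ c i z, 0 < k c i z) (hk1 : ∀ c i, ∑ z, k c i z = 1) {δ K : ℝ} (hδ : 0 ≤ δ)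
    (hdef : ∀ i, δ ≤ ∑ c, margU r c * tvDist (blockMarg (condLaw r c) i) (k c i))
    (hK : K ≤ klFin (margU r) a) :
    K + (m : ℝ) * (2 * δ ^ 2) ≤ klFin r (kerLaw a fun c => blockProd (k c)) := by
  linarith [hierarchical_volume_law hr hr1 ha hk hk1 hδ hdef]

/-- **T2-AJ, ESS form** (with T2-A `essFrac_le_exp_neg_kl`):
`ESS/N ≤ exp(−(D(r_C ‖ a) + 2 m δ²)) ≤ exp(−2 m δ²)`. [folklore] -/
theorem ess_hierarchical_volume_law {r : C × (Fin m → Z) → ℝ} (hr : ∀ z, 0 < r z)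
    (hr1 : ∑ z, r z = 1) {a : C → ℝ} (ha : ∀ c, 0 < a c) {k : C → Fin m → Z → ℝ}
    (hk : ∀ c i z, 0 < k c i z) (hk1 : ∀ c i, ∑ z, k c i z = 1) {δ : ℝ} (hδ : 0 ≤ δ)
    (hdef : ∀ i, δ ≤ ∑ c, margU r c * tvDist (blockMarg (condLaw r c) i) (k c i)) :
    essFrac r (kerLaw a fun c => blockProd (k c))
      ≤ Real.exp (-(klFin (margU r) a + (m : ℝ) * (2 * δ ^ 2))) :=
  (essFrac_le_exp_neg_kl hr (kerLaw_pos ha fun c φ => blockProd_pos (hk c) φ) hr1).trans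
    (Real.exp_le_exp.2 (neg_le_neg (hierarchical_volume_law hr hr1 ha hk hk1 hδ hdef)))

/-- **T2-AJ, ESS form without the coarse term**: `ESS/N ≤ exp(−2 m δ²)` whatever the coarse
model (Gibbs: `D(r_C ‖ a) ≥ 0` for a normalised `a`). [folklore] -/
theorem ess_hierarchical_volume_law' {r : C × (Fin m → Z) → ℝ} (hr : ∀ z, 0 < r z)
    (hr1 : ∑ z, r z = 1) {a : C → ℝ} (ha : ∀ c, 0 < a c) (ha1 : ∑ c, a c = 1)
    {k : C → Fin m → Z → ℝ} (hk : ∀ c i z, 0 < k c i z) (hk1 : ∀ c i, ∑ z, k c i z = 1)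
    {δ : ℝ} (hδ : 0 ≤ δ)
    (hdef : ∀ i, δ ≤ ∑ c, margU r c * tvDist (blockMarg (condLaw r c) i) (k c i)) :
    essFrac r (kerLaw a fun c => blockProd (k c)) ≤ Real.exp (-((m : ℝ) * (2 * δ ^ 2))) := by
  have hm : ∀ c, 0 < margU r c := margU_pos hr
  have hm1 : ∑ c, margU r c = 1 := by rw [sum_margU, hr1]
  have hK : 0 ≤ klFin (margU r) a :=
    klFin_nonneg (fun c => (hm c).le) ha (by rw [hm1, ha1])
  refine (ess_hierarchical_volume_law hr hr1 ha hk hk1 hδ hdef).trans (Real.exp_le_exp.2 ?_)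
  linarith

end Hierarchical

/-- **T2-AJ (the hierarchical / conditional volume law; typed statement of record) — PROVED
(`hierarchicalVolumeLaw`).**  For a joint target `r` on `C × (Fin m → Z)` of full support and a
model `q(c, φ) = a(c)·Π_i k_{c,i}(φ_i)` (coarse law, then the fine blocks independently GIVEN the
coarse variable — multiscale flows, domain decomposition, sector-conditioned mixtures), a mean
conditional defect `Σ_c r_C(c)·TV(r(φ_i = ·|c), k_{c,i}) ≥ δ` on every fine block forces
`D(r ‖ q) ≥ D(r_C ‖ a) + 2 m δ²`, hence (T2-A) `ESS/N ≤ e^{−D(r_C‖a)}·e^{−2 m δ²}`.  The named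
evasions of `Barriers.VolumeScalingOfTraining` / `Barriers.ReceptiveFieldLaw` ("multiscale
architectures", "non-product / conditional priors") therefore evade the volume law exactly to the
extent that conditioning on the coarse field makes the fine blocks conditionally independent in
the TARGET (`δ = 0`: Markov targets given a separator — domain decomposition, where the law is
then EXACT: companion file, `klFin_kerLaw_blockProd_eq`); otherwise the fine level pays `2 m δ²`
again, level by level.  Hypothesis (U-c) "δ > 0 uniformly in the volume" is THEORY-2.md §3.1 (hv)
— NOT asserted here; its measurable proxy is the conditional cross-cut correlator (companion
file, `condCov_le_condDefect`). [folklore] -/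
def HierarchicalVolumeLaw : Prop :=
  ∀ (C : Type) [Fintype C] (m : ℕ) (Z : Type) [Fintype Z] [DecidableEq Z] [Nonempty Z]
    (r : C × (Fin m → Z) → ℝ) (a : C → ℝ) (k : C → Fin m → Z → ℝ) (δ : ℝ),
    (∀ z, 0 < r z) → ∑ z, r z = 1 → (∀ c, 0 < a c) → (∀ c i z, 0 < k c i z) →
    (∀ c i, ∑ z, k c i z = 1) → 0 ≤ δ →
    (∀ i, δ ≤ ∑ c, margU r c *
      tvDist (blockMarg (fun φ => r (c, φ) / margU r c) i) (k c i)) →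
    klFin (margU r) a + (m : ℝ) * (2 * δ ^ 2) ≤ klFin r (fun z => a z.1 * ∏ i, k z.1 i (z.2 i))

/-- T2-AJ holds (`hierarchical_volume_law`). [folklore] -/
theorem hierarchicalVolumeLaw : HierarchicalVolumeLaw :=
  fun _ _ _ _ _ _ _ _ _ _ _ hr hr1 ha hk hk1 hδ hdef =>
    hierarchical_volume_law hr hr1 ha hk hk1 hδ hdef

end Summit.Ventures.LatticeQCDFlow.Theory2
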